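import Summits.HodgeConjecture.CorCM.Census.CyclicCharacterEvenZetaClosing

/-!
# Cyclic characters, XXXIV: EVEN KERNEL, `d = 0` — THE QUARTIC COORDINATES of a type (`k = 2`)

COR-CM (cell `pub-hodgecm2`), count-neutral kernel combinatorics by the binder seat b09 (gen 44; lane CYCLIC-CHARACTER FIBRE LAW, part XXXIV), on parts
V (`Census/CyclicCharacterArcType.lean`) and I (`Census/CyclicCharacterFibre.lean`) BY NAME.  Theorems only (no definition, no `decide` beyond numerals of
`ℤ/4`, no certificate, no named fact, no `sorry`).  HONEST FRAMING: `HC_CM` is NOT proved, here or anywhere in the tree; nothing here is a period or a headline.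

For `k = 2` (`w : G ↠ ℤ/4`, `w c = 2`) the `|G|/2` places are the points of `T_0 = F_0 ∪ F_1` (`F_j = w⁻¹(j)`), so a CM type `X` is the pair of its
FIBRE DEVIATIONS `(F_0 ∖ X, F_1 ∖ X)`; write `x_j = |F_j ∖ X|`.  This file is the dictionary every later part of the `d = 0` law uses:
* §1 numerals of `ℤ/4`; §2 the fibres have the size `n = |F_0|` of the kernel and **`x_j + x_{j+2} = n`** (`card_fib_sdiff_add`);
* §3 **`T_a = F_a ∪ F_{a+1}`** and **`ddist T_a X = x_a + x_{a+1}`** (`ddist_arcType_eq`); §4 base change shifts the coordinates: `x_j(X·Q⁻¹) = x_{j + wQ}(X)`;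
* §5 the four distances `d_0 = x_0 + x_1`, `d_1 = x_1 + n − x_0`, `d_2 = 2n − x_0 − x_1`, `d_3 = x_0 + n − x_1` and the potential `bpot X = min_a d_a`;
* §6 the regions: strictly inside the lower-left quadrant (`x_0, x_1 < m`, `n = 2m`) the arc type `T_0` is the UNIQUE nearest one; on its bottom edge
  (`x_0 = m`, `x_1 < m`) the nearest arc types are EXACTLY `T_0` and `T_1` (a two-way TIE); and **every type with a stabiliser element outside the kernel is
  BALANCED** (`x_0 = x_1 = m`, `card_fib_sdiff_eq_half_of_rt_eq`) — the only types a twisted functional cannot see, and the source of the free relation of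
  the `d = 0` certificate (parts XXXVII–XXXIX).

## References
* [Pohlmann1968] H. Pohlmann, Algebraic cycles on abelian varieties of complex multiplication type, Ann. of Math. 88 (1968), Thm 1.
-/

namespace Summit.HodgeConjecture.CorCM.Census.CyclicCharacter

open Finset
open Summit.HodgeConjecture.CorCM.Prior.AllgGroup.RfwfAllgGroup
open Summit.HodgeConjecture.CorCM.Census.BlockParity
open Summit.HodgeConjecture.CorCM.Census.Coinvariant
open Summit.HodgeConjecture.CorCM.Census.TwistGeneration
open Summit.HodgeConjecture.CorCM.Census.BaseBlock

noncomputable section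

variable {G : Type*} [Group G] [Fintype G] [DecidableEq G] {k : ℕ} {w : G → ZMod (2 ^ k)} {c : G}

/-! ## §1 Numerals of `ℤ/4` -/

omit [Fintype G] [DecidableEq G] in
/-- For `k = 2`: `2ᵏ⁻¹ = 2` in `ℤ/2ᵏ`. [folklore] -/
theorem half_eq_two (hk2 : k = 2) : ((2 ^ (k - 1) : ℕ) : ZMod (2 ^ k)) = 2 := by
  subst hk2; decide

omit [Fintype G] [DecidableEq G] in
/-- For `k = 2` every element of `ℤ/2ᵏ` is `0`, `1`, `2` or `3`. [folklore] -/
theorem eq_zero_or_one_or_two_or_three (hk2 : k = 2) (a : ZMod (2 ^ k)) : a = 0 ∨ a = 1 ∨ a = 2 ∨ a = 3 := by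
  subst hk2; revert a; decide

omit [Fintype G] [DecidableEq G] in
/-- For `k = 2`: `(v − a).val < 2ᵏ⁻¹ ↔ v = a ∨ v = a + 1`. [folklore] -/
theorem val_sub_lt_half_iff_of_two (hk2 : k = 2) (v a : ZMod (2 ^ k)) : (v - a).val < 2 ^ (k - 1) ↔ v = a ∨ v = a + 1 := by
  have key : ∀ u : ZMod (2 ^ k), u.val < 2 ^ (k - 1) ↔ u = 0 ∨ u = 1 := by subst hk2; decide
  rw [key, sub_eq_zero, sub_eq_iff_eq_add, add_comm]

omit [Fintype G] [DecidableEq G] in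
/-- For `k = 2`: `w c = 2`. [folklore] -/
theorem apply_c_eq_two (hw : ∀ P Q : G, w (P * Q) = w P + w Q) (hk : 1 ≤ k) (hk2 : k = 2) (hc2 : c * c = 1) (hwc : w c ≠ 0) : w c = 2 := by
  rw [apply_c hw hk hc2 hwc, half_eq_two hk2]

/-! ## §2 The fibres and the fibre deviations -/

omit [DecidableEq G] in
/-- **All fibres of an onto character have the size of the kernel.** [folklore] -/
theorem card_fib_eq (hw : ∀ P Q : G, w (P * Q) = w P + w Q) (h1 : ∃ g₁ : G, w g₁ = 1) (j : ZMod (2 ^ k)) :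
    (univ.filter fun s : G => w s = j).card = (univ.filter fun s : G => w s = 0).card := by
  classical
  obtain ⟨g, hg⟩ := exists_apply_eq hw h1 j
  refine (card_nbij' (fun s => s * g⁻¹) (fun s => s * g) (fun s hs => ?_) (fun s hs => ?_) (fun s _ => inv_mul_cancel_right s g)
    (fun s _ => mul_inv_cancel_right s g))
  · rw [mem_coe, mem_filter] at hs ⊢; exact ⟨mem_univ _, by rw [hw, map_inv hw, hs.2, hg, add_neg_cancel]⟩
  · rw [mem_coe, mem_filter] at hs ⊢; exact ⟨mem_univ _, by rw [hw, hs.2, hg, zero_add]⟩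

omit [Fintype G] [DecidableEq G] in
/-- `c` moves the fibre `F_j` to `F_{j+2}` (`k = 2`). [folklore] -/
theorem apply_cmul_eq_iff (hw : ∀ P Q : G, w (P * Q) = w P + w Q) (hk : 1 ≤ k) (hk2 : k = 2) (hc2 : c * c = 1) (hwc : w c ≠ 0) (j : ZMod (2 ^ k)) (s : G) :
    w (c * s) = j + 2 ↔ w s = j := by
  rw [hw, apply_c_eq_two hw hk hk2 hc2 hwc, add_comm, add_left_inj]

/-- **`x_j + x_{j+2} = n`**: the fibre deviations of a CM type at antipodal fibres are complementary (`k = 2`). [folklore] -/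
theorem card_fib_sdiff_add (hw : ∀ P Q : G, w (P * Q) = w P + w Q) (hk : 1 ≤ k) (hk2 : k = 2) (hc2 : c * c = 1) (hwc : w c ≠ 0)
    (h1 : ∃ g₁ : G, w g₁ = 1) (X : CMF G c) (j : ZMod (2 ^ k)) :
    ((univ.filter fun s : G => w s = j) \ X.1).card + ((univ.filter fun s : G => w s = j + 2) \ X.1).card = (univ.filter fun s : G => w s = 0).card := by
  -- `F_{j+2} ∖ X = c·(F_j ∩ X)`
  have himg : (univ.filter fun s : G => w s = j + 2) \ X.1 = ((univ.filter fun s : G => w s = j).filter fun s => s ∈ X.1).image fun s => c * s := by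
    ext y
    rw [mem_sdiff, mem_filter, mem_image]
    constructor
    · rintro ⟨⟨-, hy⟩, hyX⟩
      refine ⟨c * y, mem_filter.mpr ⟨mem_filter.mpr ⟨mem_univ _, ?_⟩, ?_⟩, by rw [← mul_assoc, hc2, one_mul]⟩
      · have h4 : (2 : ZMod (2 ^ k)) + 2 = 0 := by subst hk2; decide
        rw [hw, hy, apply_c_eq_two hw hk hk2 hc2 hwc, show (2 : ZMod (2 ^ k)) + (j + 2) = j + (2 + 2) by ring, h4, add_zero]
      · by_contra h; exact hyX (by have := (X.2 (c * y)); rw [← mul_assoc, hc2, one_mul] at this; tauto)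
    · rintro ⟨s, hs, rfl⟩
      rw [mem_filter, mem_filter] at hs
      exact ⟨⟨mem_univ _, (apply_cmul_eq_iff hw hk hk2 hc2 hwc j s).mpr hs.1.2⟩, (X.2 s).mp hs.2⟩
  rw [himg, card_image_of_injective _ (mul_right_injective c), filter_mem_eq_inter, ← card_fib_eq hw h1 j]
  have h := card_sdiff_add_card_inter (univ.filter fun s : G => w s = j) X.1
  omega

/-- `x_j ≤ n`. [folklore] -/
theorem card_fib_sdiff_le (hw : ∀ P Q : G, w (P * Q) = w P + w Q) (h1 : ∃ g₁ : G, w g₁ = 1) (X : CMF G c) (j : ZMod (2 ^ k)) :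
    ((univ.filter fun s : G => w s = j) \ X.1).card ≤ (univ.filter fun s : G => w s = 0).card := by
  rw [← card_fib_eq hw h1 j]; exact card_le_card sdiff_subset

/-! ## §3 Arc types for `k = 2`: `T_a = F_a ∪ F_{a+1}` and `ddist T_a X = x_a + x_{a+1}` -/

/-- For `k = 2`: `P ∈ T_a ↔ w P = a ∨ w P = a + 1`. [folklore] -/
theorem mem_arcType_iff_of_two (hw : ∀ P Q : G, w (P * Q) = w P + w Q) (hk : 1 ≤ k) (hk2 : k = 2) (hc2 : c * c = 1) (hwc : w c ≠ 0)
    (a : ZMod (2 ^ k)) (P : G) : P ∈ (arcType hw hk hc2 hwc a).1 ↔ w P = a ∨ w P = a + 1 := by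
  rw [mem_arcType, val_sub_lt_half_iff_of_two hk2]

/-- For `k = 2`: `T_a = F_a ∪ F_{a+1}`. [folklore] -/
theorem arcType_val_eq_union (hw : ∀ P Q : G, w (P * Q) = w P + w Q) (hk : 1 ≤ k) (hk2 : k = 2) (hc2 : c * c = 1) (hwc : w c ≠ 0) (a : ZMod (2 ^ k)) :
    (arcType hw hk hc2 hwc a).1 = (univ.filter fun s : G => w s = a) ∪ (univ.filter fun s : G => w s = a + 1) := by
  ext P; rw [mem_arcType_iff_of_two hw hk hk2 hc2 hwc, mem_union, mem_filter, mem_filter]; simp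

omit [Fintype G] [DecidableEq G] in
/-- `a ≠ a + 1` in `ℤ/2ᵏ` (`k ≥ 1`). [folklore] -/
theorem self_ne_add_one (hk : 1 ≤ k) (a : ZMod (2 ^ k)) : a ≠ a + 1 := by
  haveI : Fact (1 < 2 ^ k) := ⟨Nat.one_lt_two_pow (by omega)⟩
  intro h
  have : (1 : ZMod (2 ^ k)) = 0 := by
    calc (1 : ZMod (2 ^ k)) = a + 1 - a := by ring
      _ = 0 := by rw [← h, sub_self]
  exact one_ne_zero this

/-- **`T_a ∖ X = (F_a ∖ X) ⊔ (F_{a+1} ∖ X)`** (`k = 2`). [folklore] -/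
theorem sdiff_arcType_eq_union (hw : ∀ P Q : G, w (P * Q) = w P + w Q) (hk : 1 ≤ k) (hk2 : k = 2) (hc2 : c * c = 1) (hwc : w c ≠ 0)
    (a : ZMod (2 ^ k)) (X : CMF G c) :
    (arcType hw hk hc2 hwc a).1 \ X.1 = ((univ.filter fun s : G => w s = a) \ X.1) ∪ ((univ.filter fun s : G => w s = a + 1) \ X.1) := by
  rw [arcType_val_eq_union hw hk hk2 hc2 hwc, union_sdiff_distrib]

/-- The two fibre deviations of an arc type are disjoint. [folklore] -/
theorem disjoint_fib_sdiff (a b : ZMod (2 ^ k)) (hab : a ≠ b) (X : CMF G c) :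
    Disjoint ((univ.filter fun s : G => w s = a) \ X.1) ((univ.filter fun s : G => w s = b) \ X.1) := by
  rw [disjoint_left]
  intro s hs hs'
  exact hab ((mem_filter.mp (mem_sdiff.mp hs).1).2.symm.trans (mem_filter.mp (mem_sdiff.mp hs').1).2)

/-- **`ddist T_a X = x_a + x_{a+1}`** (`k = 2`). [folklore] -/
theorem ddist_arcType_eq (hw : ∀ P Q : G, w (P * Q) = w P + w Q) (hk : 1 ≤ k) (hk2 : k = 2) (hc2 : c * c = 1) (hwc : w c ≠ 0)
    (a : ZMod (2 ^ k)) (X : CMF G c) :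
    ddist (arcType hw hk hc2 hwc a) X = ((univ.filter fun s : G => w s = a) \ X.1).card + ((univ.filter fun s : G => w s = a + 1) \ X.1).card := by
  unfold ddist
  rw [sdiff_arcType_eq_union hw hk hk2 hc2 hwc, card_union_of_disjoint (disjoint_fib_sdiff a (a + 1) (self_ne_add_one hk a) X)]

/-- The bottom-fibre deviation is the bottom part of the `T_0`-deviation: `F_0 ∖ X = (T_0 ∖ X) ∩ {w = 0}`. [folklore] -/
theorem fib_zero_sdiff_eq_filter (hw : ∀ P Q : G, w (P * Q) = w P + w Q) (hk : 1 ≤ k) (hk2 : k = 2) (hc2 : c * c = 1) (hwc : w c ≠ 0) (X : CMF G c) :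
    (univ.filter fun s : G => w s = 0) \ X.1 = ((arcType hw hk hc2 hwc 0).1 \ X.1).filter fun s => w s = 0 := by
  ext s
  rw [mem_sdiff, mem_filter, mem_filter, mem_sdiff, mem_arcType_iff_of_two hw hk hk2 hc2 hwc]
  constructor
  · rintro ⟨⟨-, h⟩, h'⟩; exact ⟨⟨Or.inl h, h'⟩, h⟩
  · rintro ⟨⟨-, h'⟩, h⟩; exact ⟨⟨mem_univ _, h⟩, h'⟩

/-- The top-fibre deviation is the top part of the `T_0`-deviation: `F_1 ∖ X = (T_0 ∖ X) ∩ {w = 1}`. [folklore] -/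
theorem fib_one_sdiff_eq_filter (hw : ∀ P Q : G, w (P * Q) = w P + w Q) (hk : 1 ≤ k) (hk2 : k = 2) (hc2 : c * c = 1) (hwc : w c ≠ 0) (X : CMF G c) :
    (univ.filter fun s : G => w s = 1) \ X.1 = ((arcType hw hk hc2 hwc 0).1 \ X.1).filter fun s => w s = 1 := by
  ext s
  rw [mem_sdiff, mem_filter, mem_filter, mem_sdiff, mem_arcType_iff_of_two hw hk hk2 hc2 hwc, zero_add]
  constructor
  · rintro ⟨⟨-, h⟩, h'⟩; exact ⟨⟨Or.inr h, h'⟩, h⟩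
  · rintro ⟨⟨-, h'⟩, h⟩; exact ⟨⟨mem_univ _, h⟩, h'⟩

/-- Sub-deviation is coordinatewise: `T_0 ∖ Z ⊆ T_0 ∖ X ⟹ x_0(Z) ≤ x_0(X) ∧ x_1(Z) ≤ x_1(X)`. [folklore] -/
theorem card_fib_sdiff_le_of_sdiff_subset (hw : ∀ P Q : G, w (P * Q) = w P + w Q) (hk : 1 ≤ k) (hk2 : k = 2) (hc2 : c * c = 1) (hwc : w c ≠ 0)
    {X Z : CMF G c} (h : (arcType hw hk hc2 hwc 0).1 \ Z.1 ⊆ (arcType hw hk hc2 hwc 0).1 \ X.1) :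
    ((univ.filter fun s : G => w s = 0) \ Z.1).card ≤ ((univ.filter fun s : G => w s = 0) \ X.1).card ∧
      ((univ.filter fun s : G => w s = 1) \ Z.1).card ≤ ((univ.filter fun s : G => w s = 1) \ X.1).card := by
  rw [fib_zero_sdiff_eq_filter hw hk hk2 hc2 hwc Z, fib_zero_sdiff_eq_filter hw hk hk2 hc2 hwc X, fib_one_sdiff_eq_filter hw hk hk2 hc2 hwc Z,
    fib_one_sdiff_eq_filter hw hk hk2 hc2 hwc X]
  exact ⟨card_le_card (filter_subset_filter _ h), card_le_card (filter_subset_filter _ h)⟩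

/-! ## §4 Base change shifts the coordinates -/

/-- **`x_j(X·Q⁻¹) = x_{j + wQ}(X)`**: the fibre deviations of a base change. [folklore] -/
theorem card_fib_sdiff_rt (hw : ∀ P Q : G, w (P * Q) = w P + w Q) (Q : G) (X : CMF G c) (j : ZMod (2 ^ k)) :
    ((univ.filter fun s : G => w s = j) \ (rt c Q X).1).card = ((univ.filter fun s : G => w s = j + w Q) \ X.1).card := by
  refine card_nbij' (fun s => s * Q) (fun s => s * Q⁻¹) (fun s hs => ?_) (fun s hs => ?_) (fun s _ => mul_inv_cancel_right s Q)
    (fun s _ => inv_mul_cancel_right s Q)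
  · rw [mem_coe, mem_sdiff, mem_filter] at hs ⊢
    rw [mem_rt] at hs
    exact ⟨⟨mem_univ _, by rw [hw, hs.1.2]⟩, hs.2⟩
  · rw [mem_coe, mem_sdiff, mem_filter] at hs ⊢
    rw [mem_rt, inv_mul_cancel_right]
    exact ⟨⟨mem_univ _, by rw [hw, map_inv hw, hs.1.2, add_neg_cancel_right]⟩, hs.2⟩

/-! ## §5 The four distances and the potential -/

/-- **The four distances** of a type from the arc types, in the coordinates `x_0 = |F_0 ∖ X|`, `x_1 = |F_1 ∖ X|`, `n = |F_0|` (`k = 2`):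
`d_0 = x_0 + x_1`, `d_1 + x_0 = x_1 + n`, `d_2 + x_0 + x_1 = 2n`, `d_3 + x_1 = x_0 + n`. [folklore] -/
theorem ddist_arcType_four (hw : ∀ P Q : G, w (P * Q) = w P + w Q) (hk : 1 ≤ k) (hk2 : k = 2) (hc2 : c * c = 1) (hwc : w c ≠ 0)
    (h1 : ∃ g₁ : G, w g₁ = 1) (X : CMF G c) :
    ddist (arcType hw hk hc2 hwc 0) X = ((univ.filter fun s : G => w s = 0) \ X.1).card + ((univ.filter fun s : G => w s = 1) \ X.1).card ∧
    ddist (arcType hw hk hc2 hwc 1) X + ((univ.filter fun s : G => w s = 0) \ X.1).card =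
      ((univ.filter fun s : G => w s = 1) \ X.1).card + (univ.filter fun s : G => w s = 0).card ∧
    ddist (arcType hw hk hc2 hwc 2) X + ((univ.filter fun s : G => w s = 0) \ X.1).card + ((univ.filter fun s : G => w s = 1) \ X.1).card =
      2 * (univ.filter fun s : G => w s = 0).card ∧
    ddist (arcType hw hk hc2 hwc 3) X + ((univ.filter fun s : G => w s = 1) \ X.1).card =
      ((univ.filter fun s : G => w s = 0) \ X.1).card + (univ.filter fun s : G => w s = 0).card := by
  have e0 := ddist_arcType_eq hw hk hk2 hc2 hwc 0 X
  have e1 := ddist_arcType_eq hw hk hk2 hc2 hwc 1 X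
  have e2 := ddist_arcType_eq hw hk hk2 hc2 hwc 2 X
  have e3 := ddist_arcType_eq hw hk hk2 hc2 hwc 3 X
  have s0 := card_fib_sdiff_add hw hk hk2 hc2 hwc h1 X 0
  have s1 := card_fib_sdiff_add hw hk hk2 hc2 hwc h1 X 1
  have n01 : (0 : ZMod (2 ^ k)) + 1 = 1 := zero_add 1
  have n11 : (1 : ZMod (2 ^ k)) + 1 = 2 := by subst hk2; decide
  have n21 : (2 : ZMod (2 ^ k)) + 1 = 3 := by subst hk2; decide
  have n31 : (3 : ZMod (2 ^ k)) + 1 = 0 := by subst hk2; decide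
  have n02 : (0 : ZMod (2 ^ k)) + 2 = 2 := zero_add 2
  have n12 : (1 : ZMod (2 ^ k)) + 2 = 3 := by subst hk2; decide
  rw [n01] at e0; rw [n11] at e1; rw [n21] at e2; rw [n31] at e3; rw [n02] at s0; rw [n12] at s1
  omega

/-- Every base change of `T_0` is an arc type: `T_0·Q⁻¹ = T_{−wQ}`. [folklore] -/
theorem rt_arcType_zero_eq (hw : ∀ P Q : G, w (P * Q) = w P + w Q) (hk : 1 ≤ k) (hc2 : c * c = 1) (hwc : w c ≠ 0) (Q : G) :
    rt c Q (arcType hw hk hc2 hwc 0) = arcType hw hk hc2 hwc (-w Q) := by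
  rw [rt_arcType, zero_sub]

/-- The potential is at most the distance to any arc type. [folklore] -/
theorem bpot_le_ddist_arcType (hw : ∀ P Q : G, w (P * Q) = w P + w Q) (hk : 1 ≤ k) (hc2 : c * c = 1) (hwc : w c ≠ 0)
    (h1 : ∃ g₁ : G, w g₁ = 1) (a : ZMod (2 ^ k)) (X : CMF G c) :
    bpot c (arcType hw hk hc2 hwc 0) X ≤ ddist (arcType hw hk hc2 hwc a) X := by
  obtain ⟨Q, hQ⟩ := exists_apply_eq hw h1 (-a)
  rw [arcType_eq_rt hw hk hc2 hwc hQ]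
  exact bpot_le c _ X Q

/-- The potential is the distance to some arc type. [folklore] -/
theorem exists_bpot_eq_ddist_arcType (hw : ∀ P Q : G, w (P * Q) = w P + w Q) (hk : 1 ≤ k) (hc2 : c * c = 1) (hwc : w c ≠ 0) (X : CMF G c) :
    ∃ a : ZMod (2 ^ k), bpot c (arcType hw hk hc2 hwc 0) X = ddist (arcType hw hk hc2 hwc a) X := by
  obtain ⟨Q, hQ⟩ := exists_bpot_eq c (arcType hw hk hc2 hwc 0) X
  exact ⟨-w Q, by rw [hQ, rt_arcType_zero_eq]⟩

/-- **The potential is the least of the four distances** (`k = 2`). [folklore] -/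
theorem bpot_eq_min_four (hw : ∀ P Q : G, w (P * Q) = w P + w Q) (hk : 1 ≤ k) (hk2 : k = 2) (hc2 : c * c = 1) (hwc : w c ≠ 0)
    (h1 : ∃ g₁ : G, w g₁ = 1) (X : CMF G c) :
    bpot c (arcType hw hk hc2 hwc 0) X = min (min (ddist (arcType hw hk hc2 hwc 0) X) (ddist (arcType hw hk hc2 hwc 1) X))
      (min (ddist (arcType hw hk hc2 hwc 2) X) (ddist (arcType hw hk hc2 hwc 3) X)) := by
  have h0 := bpot_le_ddist_arcType hw hk hc2 hwc h1 0 X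
  have h1' := bpot_le_ddist_arcType hw hk hc2 hwc h1 1 X
  have h2 := bpot_le_ddist_arcType hw hk hc2 hwc h1 2 X
  have h3 := bpot_le_ddist_arcType hw hk hc2 hwc h1 3 X
  obtain ⟨a, ha⟩ := exists_bpot_eq_ddist_arcType hw hk hc2 hwc X
  rcases eq_zero_or_one_or_two_or_three hk2 a with rfl | rfl | rfl | rfl <;> omega

/-! ## §6 The regions: the open lower-left quadrant, its bottom edge, and the balanced types -/

/-- **Strictly inside the lower-left quadrant `T_0` is the unique nearest arc type**: if `2·x_0 < n` and `2·x_1 < n` then `bpot X = x_0 + x_1` and every base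
change of `T_0` realising the potential is `T_0` itself. [folklore] -/
theorem rt_eq_arcType_zero_of_lowerLeft (hw : ∀ P Q : G, w (P * Q) = w P + w Q) (hk : 1 ≤ k) (hk2 : k = 2) (hc2 : c * c = 1) (hwc : w c ≠ 0)
    (h1 : ∃ g₁ : G, w g₁ = 1) {X : CMF G c}
    (hb : 2 * ((univ.filter fun s : G => w s = 0) \ X.1).card < (univ.filter fun s : G => w s = 0).card)
    (hv : 2 * ((univ.filter fun s : G => w s = 1) \ X.1).card < (univ.filter fun s : G => w s = 0).card) :
    bpot c (arcType hw hk hc2 hwc 0) X = ((univ.filter fun s : G => w s = 0) \ X.1).card + ((univ.filter fun s : G => w s = 1) \ X.1).card ∧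
    ∀ Q : G, bpot c (arcType hw hk hc2 hwc 0) X = ddist (rt c Q (arcType hw hk hc2 hwc 0)) X → rt c Q (arcType hw hk hc2 hwc 0) = arcType hw hk hc2 hwc 0 := by
  obtain ⟨e0, e1, e2, e3⟩ := ddist_arcType_four hw hk hk2 hc2 hwc h1 X
  have hmin := bpot_eq_min_four hw hk hk2 hc2 hwc h1 X
  refine ⟨by omega, fun Q hQ => ?_⟩
  rw [rt_arcType_zero_eq] at hQ ⊢
  rcases eq_zero_or_one_or_two_or_three hk2 (-w Q) with h | h | h | h <;> rw [h] at hQ ⊢ <;> first | rfl | omega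

/-- **On the bottom edge of the lower-left quadrant the nearest arc types are exactly `T_0` and `T_1`**: if `2·x_0 = n` and `2·x_1 < n` then
`bpot X = x_0 + x_1` and a base change of `T_0` realises the potential iff it is `T_0` or `T_1`. [folklore] -/
theorem rt_eq_arcType_zero_or_one_of_bottomEdge (hw : ∀ P Q : G, w (P * Q) = w P + w Q) (hk : 1 ≤ k) (hk2 : k = 2) (hc2 : c * c = 1) (hwc : w c ≠ 0)
    (h1 : ∃ g₁ : G, w g₁ = 1) {X : CMF G c}
    (hb : 2 * ((univ.filter fun s : G => w s = 0) \ X.1).card = (univ.filter fun s : G => w s = 0).card)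
    (hv : 2 * ((univ.filter fun s : G => w s = 1) \ X.1).card < (univ.filter fun s : G => w s = 0).card) :
    bpot c (arcType hw hk hc2 hwc 0) X = ((univ.filter fun s : G => w s = 0) \ X.1).card + ((univ.filter fun s : G => w s = 1) \ X.1).card ∧
    ∀ Q : G, bpot c (arcType hw hk hc2 hwc 0) X = ddist (rt c Q (arcType hw hk hc2 hwc 0)) X ↔
      (rt c Q (arcType hw hk hc2 hwc 0) = arcType hw hk hc2 hwc 0 ∨ rt c Q (arcType hw hk hc2 hwc 0) = arcType hw hk hc2 hwc 1) := by
  obtain ⟨e0, e1, e2, e3⟩ := ddist_arcType_four hw hk hk2 hc2 hwc h1 X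
  have hmin := bpot_eq_min_four hw hk hk2 hc2 hwc h1 X
  have hinj := arcType_injective hw hk hc2 hwc h1
  have n20 : (2 : ZMod (2 ^ k)) ≠ 0 := by subst hk2; decide
  have n21 : (2 : ZMod (2 ^ k)) ≠ 1 := by subst hk2; decide
  have n30 : (3 : ZMod (2 ^ k)) ≠ 0 := by subst hk2; decide
  have n31 : (3 : ZMod (2 ^ k)) ≠ 1 := by subst hk2; decide
  refine ⟨by omega, fun Q => ?_⟩
  rw [rt_arcType_zero_eq]
  rcases eq_zero_or_one_or_two_or_three hk2 (-w Q) with h | h | h | h <;> rw [h]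
  · exact ⟨fun _ => Or.inl rfl, fun _ => by omega⟩
  · exact ⟨fun _ => Or.inr rfl, fun _ => by omega⟩
  · constructor
    · intro h'; exfalso; omega
    · rintro (h' | h'); exacts [absurd (hinj h') n20, absurd (hinj h') n21]
  · constructor
    · intro h'; exfalso; omega
    · rintro (h' | h'); exacts [absurd (hinj h') n30, absurd (hinj h') n31]

/-- **EVERY TYPE WITH A STABILISER ELEMENT OUTSIDE THE KERNEL IS BALANCED** (`k = 2`): if `X·Q⁻¹ = X` with `w Q ≠ 0` then `2·x_0 = 2·x_1 = n`. [folklore] -/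
theorem card_fib_sdiff_eq_half_of_rt_eq (hw : ∀ P Q : G, w (P * Q) = w P + w Q) (hk : 1 ≤ k) (hk2 : k = 2) (hc2 : c * c = 1) (hwc : w c ≠ 0)
    (h1 : ∃ g₁ : G, w g₁ = 1) {X : CMF G c} {Q : G} (hQ : rt c Q X = X) (hwQ : w Q ≠ 0) :
    2 * ((univ.filter fun s : G => w s = 0) \ X.1).card = (univ.filter fun s : G => w s = 0).card ∧
      2 * ((univ.filter fun s : G => w s = 1) \ X.1).card = (univ.filter fun s : G => w s = 0).card := by
  have hsh : ∀ j : ZMod (2 ^ k), ((univ.filter fun s : G => w s = j) \ X.1).card = ((univ.filter fun s : G => w s = j + w Q) \ X.1).card := by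
    intro j; rw [← card_fib_sdiff_rt hw Q X j, hQ]
  have s0 := card_fib_sdiff_add hw hk hk2 hc2 hwc h1 X 0
  have s1 := card_fib_sdiff_add hw hk hk2 hc2 hwc h1 X 1
  have n02 : (0 : ZMod (2 ^ k)) + 2 = 2 := zero_add 2
  have n12 : (1 : ZMod (2 ^ k)) + 2 = 3 := by subst hk2; decide
  rw [n02] at s0; rw [n12] at s1
  rcases eq_zero_or_one_or_two_or_three hk2 (w Q) with h | h | h | h
  · exact absurd h hwQ
  · have a0 := hsh 0; have a1 := hsh 1; have a2 := hsh 2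
    rw [h, zero_add] at a0; rw [h, show (1 : ZMod (2 ^ k)) + 1 = 2 by subst hk2; decide] at a1
    rw [h, show (2 : ZMod (2 ^ k)) + 1 = 3 by subst hk2; decide] at a2
    omega
  · have a0 := hsh 0; have a1 := hsh 1
    rw [h, zero_add] at a0; rw [h, n12] at a1
    omega
  · have a0 := hsh 0; have a3 := hsh 3; have a2 := hsh 2
    rw [h, zero_add] at a0; rw [h, show (3 : ZMod (2 ^ k)) + 3 = 2 by subst hk2; decide] at a3
    rw [h, show (2 : ZMod (2 ^ k)) + 3 = 1 by subst hk2; decide] at a2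
    omega

/-- **Balanced types have potential `n`**; every other type has potential `< n` (`k = 2`, `n = 2m`). [folklore] -/
theorem bpot_lt_card_ker_iff (hw : ∀ P Q : G, w (P * Q) = w P + w Q) (hk : 1 ≤ k) (hk2 : k = 2) (hc2 : c * c = 1) (hwc : w c ≠ 0)
    (h1 : ∃ g₁ : G, w g₁ = 1) {m : ℕ} (hm : 2 * m = (univ.filter fun s : G => w s = 0).card) (X : CMF G c) :
    bpot c (arcType hw hk hc2 hwc 0) X < (univ.filter fun s : G => w s = 0).card ↔
      ¬ (((univ.filter fun s : G => w s = 0) \ X.1).card = m ∧ ((univ.filter fun s : G => w s = 1) \ X.1).card = m) := by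
  obtain ⟨e0, e1, e2, e3⟩ := ddist_arcType_four hw hk hk2 hc2 hwc h1 X
  have hmin := bpot_eq_min_four hw hk hk2 hc2 hwc h1 X
  have hb := card_fib_sdiff_le hw h1 X 0
  have hv := card_fib_sdiff_le hw h1 X 1
  omega

/-- **A stabiliser element outside the kernel forces potential `n`.** [folklore] -/
theorem bpot_eq_card_ker_of_rt_eq (hw : ∀ P Q : G, w (P * Q) = w P + w Q) (hk : 1 ≤ k) (hk2 : k = 2) (hc2 : c * c = 1) (hwc : w c ≠ 0)
    (h1 : ∃ g₁ : G, w g₁ = 1) {X : CMF G c} {Q : G} (hQ : rt c Q X = X) (hwQ : w Q ≠ 0) :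
    bpot c (arcType hw hk hc2 hwc 0) X = (univ.filter fun s : G => w s = 0).card := by
  obtain ⟨hb, hv⟩ := card_fib_sdiff_eq_half_of_rt_eq hw hk hk2 hc2 hwc h1 hQ hwQ
  obtain ⟨e0, e1, e2, e3⟩ := ddist_arcType_four hw hk hk2 hc2 hwc h1 X
  have hmin := bpot_eq_min_four hw hk hk2 hc2 hwc h1 X
  omega

end

end Summit.HodgeConjecture.CorCM.Census.CyclicCharacter
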